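import Summits.HodgeConjecture.HodgeConjecture.Theorems.VHCAbelianSchemesRoadOneCarriedSeedTransfer
import HarnessLib

/-!
# Road b02 (`VHCAbelianSchemesRoad`, D-0059) — crux `SemiregularSheafRepresentativesTwPrimeAtDiagLocal` (item stmt-HodgeConjecture-23176),
# stub 2a′₀: the OFF-HYPERELLIPTIC half of the one-direction transfer node G1♭′ is print READ IN ∀-FORM WITH THE PIN PRESCRIBED —
# the one Lean signature the LEAD asked for, elaborated, and its fact-free discharge of `…OffHyperelliptic`; hence
# 2a′₀ ⟸ L1″ ∧ L1″_∀ ∧ At′ (hypothesis form; nothing asserted)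

research route conditional on HC_CM; not a corollary; Q11.4-sentence-2 already refuted in dim ≥ 3.

THEOREMS ONLY (no definition, no new named fact, no sorry; `HC_CM` nowhere). ring2-b03x gen 8, second half of the plate of director-hodge g12
R12.3 (4) ∕ LEAD 160 START-HERE (ring2 INBOX 2026-08-28T00:17:27Z): «… else report the exact gap as ONE Lean signature for LEAD».
Companion of `VHCAbelianSchemesRoadOneCarriedSeedTransfer` (p590217: modulo L1″(C, AdmTw′), 2a′₀(C) ⟺ G1♭′(C) =
`SecantQuotientPinnedAnchorLevelTransfer63PinnedPrime C`), and of ring2-b03 g87's hyperelliptic split G1♭ ⟺ Off ∧ At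
(`…SecantQuotientHyperellipticLevelTransferDefs`). `--supports stmt-HodgeConjecture-23176`.

THE SIGNATURE (displayed as the HYPOTHESIS `hMall` of every theorem below; it is NOT a tree fact and NOT asserted): **L1″_∀(C, Adm) := print's pinned
claim `HodgeTheory.Markman2025_secantQuotient_twistedCarrier_onJacobian_pinned C Adm` with its leading `∃` over the construction data turned into
`∀` over NON-HYPERELLIPTIC data and with the pin PRESCRIBED** — for every even `d ≥ 4`, every smooth projective curve `Cᵥ` with a Jacobian `𝒥` of
dimension `3`, Riemann theta divisor `Θ` (principal), cyclic `G₁, G₂ ≤ J[d+1](ℂ)` of order `d+1` meeting trivially with the `(d+1)²` translates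
`τ_{g₁+g₂}(Θ)` in general position (EXACTLY the fields of the road's `SecantQuotientDatum`), **`¬ 𝒥.IsHyperelliptic`** (`Motives.Jacobian.IsHyperelliptic`,
typed since ring2-b03 g87), and EVERY polarisation class `θ₀` of `Θ` (`IsPolarizationClassOf Θ θ₀`, i.e. `θ₀ ∈ ℚˣ·[Θ]`): some `γ` with
`IsTwistedCarrierWeilPairOn C Adm 𝒥.J … d (h_Y θ₀) γ` (the clause package of the claim, verbatim). Print-faithfulness of L1″_∀ is a TYPER ∕
REFUTER question, not settled here: arXiv:2502.03415 §9 opens with «Let `C` be a non-hyperelliptic curve of genus 3» (p. 57) and uses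
non-hyperellipticity through Prop. 9.2.2 (reflexivity of rank `8d`) and the rank-6 obstruction map behind Lemma 9.3.11; Lemma 9.3.1's general
position is a datum field; the remaining genericity in print is Assumption 9.1.1 ∕ Lemma 9.1.2 («holds for `d ≥ 3` for a generic choice of the
`Cᵢ`'s» — the base translates of the `G₁`- ∕ `G₂`-orbits, a choice made INSIDE the construction at a fixed datum); prescribing the pin costs nothing
(`κ₃ = γ₀ + c₃h³`, `h ↦ q·h`, `q ∈ ℚˣ`, rescales `c₃` only — `carriedClasses_smul_iff`, `IsSecantQuotientWeilClassAtPinned.ratSmul`). If the typer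
files L1″_∀ as a claim-fact, `hMall` is discharged BY NAME with zero glue (the hypothesis is spelled in the claim-fact's own binders).

RESULTS (fact-free): §1 `exists_carried_pinned_of_presentedOffHyperelliptic_of_markmanPinnedForall` — L1″_∀(C, Adm) gives, at every `(X, θ)`
PRESENTED by a non-hyperelliptic datum (`e : X ≅ D.Y.X`, `e⁻¹^*θ = h_Y(θ₀)`, `θ₀ ∈ ℚˣ·[Θ_D]`), a rational pinned-served class carried by a
`tw C Adm`-datum (apply L1″_∀ AT `D` AND AT THE TARGET'S OWN PIN `θ₀`, read the every-copy clause at the chart `e`; no seed, no transfer, no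
rational-ratio lemma); hence `offHyperelliptic_of_markmanPinnedForall` — **L1″_∀(C, Adm) ⟹ `SecantQuotientPinnedAnchorLevelTransfer63OffHyperelliptic
(tw C Adm)`** (source idle). §2 at the primed door: the primed Off′, and **2a′₀(C) ⟸ L1″(C, AdmTw′) ∧ L1″_∀(C, AdmTw′) ∧ At′(C)**
(`oneCarried_63_twPrime_of_markmanPinned_of_markmanPinnedForall_of_atHyperelliptic`; L1″ still supplies the SEED that At′ transfers to the
hyperelliptic anchors — L1″_∀ ⟹ L1″ needs the existence of a non-hyperelliptic datum at every even level, not in the tree), so that MODULO PRINT IN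
BOTH FORMS the registered stub 2a′₀ is EXACTLY the at-hyperelliptic closedness node `SecantQuotientPinnedAnchorLevelTransfer63AtHyperellipticPinnedPrime C`
(research; print silent).

Nothing here says L1″, L1″_∀, Off, At, G1♭, 2a′₀, any cell, the crux, K-SR♭∃, VHC, `HC_AV`, `HC_CM` or HC holds; HC_CM HELD, by name only; typed ≠
proved. References: [cite: Markman2025SecantWeil, §1.3 (p. 5), §1.5 (p. 7), Thm. 1.4.1 (item 4), §9 (p. 57), §9.1 Lemma 9.1.2, §9.2 Prop. 9.2.2,
§9.3 Lemma 9.3.1, Remark 9.3.7 and Lemma 9.3.11] [cite: ArbarelloCornalbaGriffithsHarris1985, Ch. I §2 (p. 10)] [cite: Bloch1972Semiregularity, Remark (7.5)]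
[cite: BuchweitzFlenner2003, §5 Thm. 5.1].
-/

noncomputable section

open CategoryTheory CategoryTheory.Limits AlgebraicGeometry Topology

namespace Summit.HodgeConjecture.HodgeConjecture.Ring2.SemiregularRepresentatives

set_option linter.dupNamespace false -- the cell's namespace repeats the summit name, as in every `Ring2*` file

open Literature.AlgebraicGeometry Literature.AlgebraicGeometry.Motives Literature.AlgebraicGeometry.Motives.AbelianVariety
open Literature.AlgebraicGeometry.HodgeTheory Literature.AlgebraicGeometry.Markman2025
open Literature.AlgebraicTopology.SingularHomology
open Summit.Ventures.HSemireg (ObjClass)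
open Summit.HodgeConjecture.HodgeConjecture.Ring2.AbelianAll (carriedClasses)

/-! ## §1 L1″_∀ (displayed) discharges the off-hyperelliptic half of G1♭, for any admissibility notion -/

section AnyDoor

variable {C : ChernCharacterBetti} {Adm : PerfectAdmissibility}

/-- **At a pinned anchor PRESENTED BY A NON-HYPERELLIPTIC DATUM, L1″_∀(C, Adm) puts a carried rational pinned-served class** — apply the displayed
∀-form of print's pinned claim AT the presenting datum `D` AND AT THE TARGET'S OWN PIN `θ₀`, take the pinned clauses at the identity chart
(`IsSecantQuotientWeilClassAtPinned.of_refl`), move them along the chart `e : X ≅ D.Y.X` (`of_iso`), and read the claim's every-copy datum at `e`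
(`κ₃ = e^*γ + c₃·(e^*h_Y θ₀)³ = e^*γ + c₃·θ³`, `a = 1`). No seed, no transfer, no ratio lemma. `hMall` is a HYPOTHESIS (module docstring).
[cite: Markman2025SecantWeil, §1.5 (p. 7), Thm. 1.4.1 (item 4), §9 (p. 57) and §9.3 Lemma 9.3.11] [cite: Bloch1972Semiregularity, Remark (7.5)] -/
theorem exists_carried_pinned_of_presentedOffHyperelliptic_of_markmanPinnedForall
    (hMall : ∀ d : ℕ, Even d → 4 ≤ d →
      ∀ (Cᵥ : SchemeOver ℂ) (_ : IsSmoothProjective 1 Cᵥ) (𝒥 : Jacobian Cᵥ) (_ : 𝒥.J.dim = 3)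
        (Θ : CartierDivisor 𝒥.J.X.left) (_ : 𝒥.IsRiemannThetaDivisor Θ) (hP : 𝒥.J.IsPrincipalPolarizationDivisor Θ)
        (G₁ G₂ : Subgroup (𝒥.J.Points ℂ)) (h₁ : G₁ ≤ 𝒥.J.torsionPoints ℂ (d + 1 : ℕ))
        (h₂ : G₂ ≤ 𝒥.J.torsionPoints ℂ (d + 1 : ℕ)),
        ¬ 𝒥.IsHyperelliptic →
        IsCyclic G₁ → Nat.card G₁ = d + 1 → IsCyclic G₂ → Nat.card G₂ = d + 1 → G₁ ⊓ G₂ = ⊥ →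
        TranslatesInGeneralPosition 𝒥.J Θ (sumSet G₁ G₂) →
        ∀ θ₀ : complexBetti 𝒥.J.X 2, 𝒥.J.IsPolarizationClassOf Θ θ₀ →
          ∃ γ, IsTwistedCarrierWeilPairOn C Adm 𝒥.J hP.isAmple hP.KTheta_eq_bot G₁ G₂ (Nat.succ_ne_zero d) h₁ h₂ d
            (secantPolarizationClass 𝒥.J hP.isAmple G₁ G₂ (Nat.succ_ne_zero d) h₁ h₂ d θ₀) γ)
    {X : SchemeOver ℂ} {θ : complexBetti X 2}
    (hpres : ∃ (D : SecantQuotientDatum) (e : X ≅ D.Y.X) (θ₀ : complexBetti D.𝒥.J.X 2),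
      ¬ D.𝒥.IsHyperelliptic ∧ D.𝒥.J.IsPolarizationClassOf D.Θ θ₀ ∧ complexBetti.map e.inv 2 θ = D.hY θ₀) :
    ∃ w : complexBetti X (2 * 3), w ∈ secantQuotientServedClassesPinned X θ ∧ IsRationalClass w ∧
      w ∈ carriedClasses (twistedReflexiveClass C Adm) 6 3 X θ := by
  obtain ⟨D, e, θ₀, hnh, hθ₀, hpin⟩ := hpres
  -- print's ∀-form at the datum `D` and the target's own pin `θ₀`, re-typed over `D`'s projections
  have hD : ∃ γ : complexBetti D.Y.X (2 * 3), IsTwistedCarrierWeilPairOn C Adm D.𝒥.J D.isAmple D.KTheta_eq_bot D.G₁ D.G₂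
      D.succ_ne_zero D.G₁_le D.G₂_le D.d (D.hY θ₀) γ :=
    hMall D.d D.even D.four_le D.C D.smooth D.𝒥 D.dim_J D.Θ D.riemann D.principal D.G₁ D.G₂ D.G₁_le D.G₂_le hnh
      D.cyclic₁ D.card₁ D.cyclic₂ D.card₂ D.disjoint D.generalPosition θ₀ hθ₀
  obtain ⟨γ, hpol, hamp, hhyp, hγQ, hγray, hγW, hcopy⟩ := hD
  have hW : IsSecantQuotientWeilClassAtPinned D.Y.X (D.hY θ₀) γ :=
    IsSecantQuotientWeilClassAtPinned.of_refl D hθ₀ hpol hamp hhyp hγQ hγray hγW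
  have hθ : θ = complexBetti.map e.hom 2 (D.hY θ₀) := by rw [← hpin, e.complexBetti_map_hom_map_inv]
  obtain ⟨I, κ, c, h3, hκ, hκ3, hκk⟩ := hcopy X e
  refine ⟨complexBetti.map e.hom (2 * 3) γ, ?_, hγQ.map _, I, κ, 1, c, h3, hκ, one_ne_zero, ?_, fun k hk hk3 ↦ ?_⟩
  · rw [hθ]; exact hW.of_iso e
  · rw [one_smul, hθ]; exact hκ3
  · rw [hθ]; exact hκk k hk hk3

/-- **L1″_∀(C, Adm) ⟹ THE OFF-HYPERELLIPTIC HALF OF G1♭ for the door `tw C Adm`** (`SecantQuotientPinnedAnchorLevelTransfer63OffHyperelliptic`): the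
source anchor and the seed are idle — print read in ∀-form with the pin prescribed serves every off-hyperelliptic pinned target directly. `hMall` is a
HYPOTHESIS. [cite: Markman2025SecantWeil, §9 (p. 57), §9.3 Lemma 9.3.1 and Lemma 9.3.11] [cite: ArbarelloCornalbaGriffithsHarris1985, Ch. I §2 (p. 10)]
[cite: Bloch1972Semiregularity, Remark (7.5)] -/
theorem offHyperelliptic_of_markmanPinnedForall
    (hMall : ∀ d : ℕ, Even d → 4 ≤ d →
      ∀ (Cᵥ : SchemeOver ℂ) (_ : IsSmoothProjective 1 Cᵥ) (𝒥 : Jacobian Cᵥ) (_ : 𝒥.J.dim = 3)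
        (Θ : CartierDivisor 𝒥.J.X.left) (_ : 𝒥.IsRiemannThetaDivisor Θ) (hP : 𝒥.J.IsPrincipalPolarizationDivisor Θ)
        (G₁ G₂ : Subgroup (𝒥.J.Points ℂ)) (h₁ : G₁ ≤ 𝒥.J.torsionPoints ℂ (d + 1 : ℕ))
        (h₂ : G₂ ≤ 𝒥.J.torsionPoints ℂ (d + 1 : ℕ)),
        ¬ 𝒥.IsHyperelliptic →
        IsCyclic G₁ → Nat.card G₁ = d + 1 → IsCyclic G₂ → Nat.card G₂ = d + 1 → G₁ ⊓ G₂ = ⊥ →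
        TranslatesInGeneralPosition 𝒥.J Θ (sumSet G₁ G₂) →
        ∀ θ₀ : complexBetti 𝒥.J.X 2, 𝒥.J.IsPolarizationClassOf Θ θ₀ →
          ∃ γ, IsTwistedCarrierWeilPairOn C Adm 𝒥.J hP.isAmple hP.KTheta_eq_bot G₁ G₂ (Nat.succ_ne_zero d) h₁ h₂ d
            (secantPolarizationClass 𝒥.J hP.isAmple G₁ G₂ (Nat.succ_ne_zero d) h₁ h₂ d θ₀) γ) :
    SecantQuotientPinnedAnchorLevelTransfer63OffHyperelliptic (twistedReflexiveClass C Adm) :=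
  fun _ _ _ _ _ _ _ hpres _ _ ↦ exists_carried_pinned_of_presentedOffHyperelliptic_of_markmanPinnedForall hMall hpres

end AnyDoor

/-! ## §2 At the primed door `tw C AdmTw′`: Off′ from L1″_∀; stub 2a′₀ from L1″ ∧ L1″_∀ ∧ At′ -/

section TwPrime

/-- **L1″_∀(C, AdmTw′) ⟹ Off′(C)** (`SecantQuotientPinnedAnchorLevelTransfer63OffHyperellipticPinnedPrime C`). `hMall` is a HYPOTHESIS.
[cite: Markman2025SecantWeil, §9 (p. 57) and §9.3 Lemma 9.3.11] [cite: BuchweitzFlenner2003, §5 Thm. 5.1] -/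
theorem offHyperellipticPinnedPrime_of_markmanPinnedForall (C : ChernCharacterBetti)
    (hMall : ∀ d : ℕ, Even d → 4 ≤ d →
      ∀ (Cᵥ : SchemeOver ℂ) (_ : IsSmoothProjective 1 Cᵥ) (𝒥 : Jacobian Cᵥ) (_ : 𝒥.J.dim = 3)
        (Θ : CartierDivisor 𝒥.J.X.left) (_ : 𝒥.IsRiemannThetaDivisor Θ) (hP : 𝒥.J.IsPrincipalPolarizationDivisor Θ)
        (G₁ G₂ : Subgroup (𝒥.J.Points ℂ)) (h₁ : G₁ ≤ 𝒥.J.torsionPoints ℂ (d + 1 : ℕ))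
        (h₂ : G₂ ≤ 𝒥.J.torsionPoints ℂ (d + 1 : ℕ)),
        ¬ 𝒥.IsHyperelliptic →
        IsCyclic G₁ → Nat.card G₁ = d + 1 → IsCyclic G₂ → Nat.card G₂ = d + 1 → G₁ ⊓ G₂ = ⊥ →
        TranslatesInGeneralPosition 𝒥.J Θ (sumSet G₁ G₂) →
        ∀ θ₀ : complexBetti 𝒥.J.X 2, 𝒥.J.IsPolarizationClassOf Θ θ₀ →
          ∃ γ, IsTwistedCarrierWeilPairOn C
            (fun n X₀ I E => Summit.Ventures.HSemireg.gluableSigmaAdmissible n X₀ I E ∨ bfSingleAdmissible' n X₀ I E)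
            𝒥.J hP.isAmple hP.KTheta_eq_bot G₁ G₂ (Nat.succ_ne_zero d) h₁ h₂ d
            (secantPolarizationClass 𝒥.J hP.isAmple G₁ G₂ (Nat.succ_ne_zero d) h₁ h₂ d θ₀) γ) :
    SecantQuotientPinnedAnchorLevelTransfer63OffHyperellipticPinnedPrime C :=
  offHyperelliptic_of_markmanPinnedForall hMall

/-- **STUB 2a′₀ FROM PRINT IN BOTH FORMS AND THE AT-HYPERELLIPTIC CLOSEDNESS NODE: L1″(C, AdmTw′) ∧ L1″_∀(C, AdmTw′) ∧ At′(C) ⟹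
‹`stub_oneCarried_63_secantQuotientPinnedPrime`'s statement at `C`, verbatim›** — L1″ (∃-form) seeds every even level, L1″_∀ serves every
off-hyperelliptic pinned anchor outright (§1), At′ (`SecantQuotientPinnedAnchorLevelTransfer63AtHyperellipticPinnedPrime C`) moves the seed to the
hyperelliptic ones; assembled through `pinnedLevelTransfer63_of_offHyperelliptic_of_atHyperelliptic` and p590217's
`oneCarried_63_twPrime_of_markmanPinned_of_pinnedLevelTransfer`. So MODULO PRINT IN BOTH FORMS the registered stub is exactly the research node At′.
All three inputs OPEN, hypotheses here; nothing asserted. [cite: Markman2025SecantWeil, §1.5 (p. 7), Thm. 1.4.1 (item 4), §9 (p. 57) and §9.3 Lemma 9.3.11]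
[cite: ArbarelloCornalbaGriffithsHarris1985, Ch. I §2 (p. 10)] [cite: Bloch1972Semiregularity, Remark (7.5)] [cite: BuchweitzFlenner2003, §5 Thm. 5.1] -/
theorem oneCarried_63_twPrime_of_markmanPinned_of_markmanPinnedForall_of_atHyperelliptic (C : ChernCharacterBetti)
    (hM : Markman2025_secantQuotient_twistedCarrier_onJacobian_pinned C
      (fun n X₀ I E => Summit.Ventures.HSemireg.gluableSigmaAdmissible n X₀ I E ∨ bfSingleAdmissible' n X₀ I E))
    (hMall : ∀ d : ℕ, Even d → 4 ≤ d →
      ∀ (Cᵥ : SchemeOver ℂ) (_ : IsSmoothProjective 1 Cᵥ) (𝒥 : Jacobian Cᵥ) (_ : 𝒥.J.dim = 3)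
        (Θ : CartierDivisor 𝒥.J.X.left) (_ : 𝒥.IsRiemannThetaDivisor Θ) (hP : 𝒥.J.IsPrincipalPolarizationDivisor Θ)
        (G₁ G₂ : Subgroup (𝒥.J.Points ℂ)) (h₁ : G₁ ≤ 𝒥.J.torsionPoints ℂ (d + 1 : ℕ))
        (h₂ : G₂ ≤ 𝒥.J.torsionPoints ℂ (d + 1 : ℕ)),
        ¬ 𝒥.IsHyperelliptic →
        IsCyclic G₁ → Nat.card G₁ = d + 1 → IsCyclic G₂ → Nat.card G₂ = d + 1 → G₁ ⊓ G₂ = ⊥ →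
        TranslatesInGeneralPosition 𝒥.J Θ (sumSet G₁ G₂) →
        ∀ θ₀ : complexBetti 𝒥.J.X 2, 𝒥.J.IsPolarizationClassOf Θ θ₀ →
          ∃ γ, IsTwistedCarrierWeilPairOn C
            (fun n X₀ I E => Summit.Ventures.HSemireg.gluableSigmaAdmissible n X₀ I E ∨ bfSingleAdmissible' n X₀ I E)
            𝒥.J hP.isAmple hP.KTheta_eq_bot G₁ G₂ (Nat.succ_ne_zero d) h₁ h₂ d
            (secantPolarizationClass 𝒥.J hP.isAmple G₁ G₂ (Nat.succ_ne_zero d) h₁ h₂ d θ₀) γ)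
    (hat : SecantQuotientPinnedAnchorLevelTransfer63AtHyperellipticPinnedPrime C) :
    ∀ (Y : SchemeOver ℂ) (θ : complexBetti Y 2), secantQuotientAnchorsPinned Y θ →
      ∃ γ₁ ∈ secantQuotientServedClassesPinned Y θ,
        γ₁ ∈ Summit.HodgeConjecture.HodgeConjecture.Ring2.AbelianAll.carriedClasses
          (twistedReflexiveClass C (fun n X₀ I E => Summit.Ventures.HSemireg.gluableSigmaAdmissible n X₀ I E ∨ bfSingleAdmissible' n X₀ I E)) 6 3 Y θ :=
  oneCarried_63_twPrime_of_markmanPinned_of_offHyperelliptic_of_atHyperelliptic C hM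
    (offHyperellipticPinnedPrime_of_markmanPinnedForall C hMall) hat

/-- **Off the hyperelliptic locus 2a′₀'s conclusion needs L1″_∀ ALONE** (no seed, no At′): at every pinned anchor presented by a non-hyperelliptic
datum some pinned-served class is `tw C AdmTw′`-carried. [cite: Markman2025SecantWeil, §9 (p. 57) and §9.3 Lemma 9.3.11] [cite: Bloch1972Semiregularity, Remark (7.5)] -/
theorem oneCarried_63_twPrime_at_presentedOffHyperelliptic_of_markmanPinnedForall (C : ChernCharacterBetti)
    (hMall : ∀ d : ℕ, Even d → 4 ≤ d →
      ∀ (Cᵥ : SchemeOver ℂ) (_ : IsSmoothProjective 1 Cᵥ) (𝒥 : Jacobian Cᵥ) (_ : 𝒥.J.dim = 3)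
        (Θ : CartierDivisor 𝒥.J.X.left) (_ : 𝒥.IsRiemannThetaDivisor Θ) (hP : 𝒥.J.IsPrincipalPolarizationDivisor Θ)
        (G₁ G₂ : Subgroup (𝒥.J.Points ℂ)) (h₁ : G₁ ≤ 𝒥.J.torsionPoints ℂ (d + 1 : ℕ))
        (h₂ : G₂ ≤ 𝒥.J.torsionPoints ℂ (d + 1 : ℕ)),
        ¬ 𝒥.IsHyperelliptic →
        IsCyclic G₁ → Nat.card G₁ = d + 1 → IsCyclic G₂ → Nat.card G₂ = d + 1 → G₁ ⊓ G₂ = ⊥ →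
        TranslatesInGeneralPosition 𝒥.J Θ (sumSet G₁ G₂) →
        ∀ θ₀ : complexBetti 𝒥.J.X 2, 𝒥.J.IsPolarizationClassOf Θ θ₀ →
          ∃ γ, IsTwistedCarrierWeilPairOn C
            (fun n X₀ I E => Summit.Ventures.HSemireg.gluableSigmaAdmissible n X₀ I E ∨ bfSingleAdmissible' n X₀ I E)
            𝒥.J hP.isAmple hP.KTheta_eq_bot G₁ G₂ (Nat.succ_ne_zero d) h₁ h₂ d
            (secantPolarizationClass 𝒥.J hP.isAmple G₁ G₂ (Nat.succ_ne_zero d) h₁ h₂ d θ₀) γ) :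
    ∀ (Y : SchemeOver ℂ) (θ : complexBetti Y 2),
      (∃ (D : SecantQuotientDatum) (e : Y ≅ D.Y.X) (θ₀ : complexBetti D.𝒥.J.X 2),
        ¬ D.𝒥.IsHyperelliptic ∧ D.𝒥.J.IsPolarizationClassOf D.Θ θ₀ ∧ complexBetti.map e.inv 2 θ = D.hY θ₀) →
      ∃ γ₁ ∈ secantQuotientServedClassesPinned Y θ,
        γ₁ ∈ Summit.HodgeConjecture.HodgeConjecture.Ring2.AbelianAll.carriedClasses
          (twistedReflexiveClass C (fun n X₀ I E => Summit.Ventures.HSemireg.gluableSigmaAdmissible n X₀ I E ∨ bfSingleAdmissible' n X₀ I E)) 6 3 Y θ := by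
  intro Y θ hpres
  obtain ⟨w, hw, -, hwc⟩ := exists_carried_pinned_of_presentedOffHyperelliptic_of_markmanPinnedForall hMall hpres
  exact ⟨w, hw, hwc⟩

end TwPrime

#print axioms exists_carried_pinned_of_presentedOffHyperelliptic_of_markmanPinnedForall
#print axioms oneCarried_63_twPrime_of_markmanPinned_of_markmanPinnedForall_of_atHyperelliptic

end Summit.HodgeConjecture.HodgeConjecture.Ring2.SemiregularRepresentatives

end
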